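/-
Copyright: the b2b-balaban T⁴-continuum CRUX team, row NE7b OWNER lineage `t4-ne7b-p1` (gen 134). Project licence.
-/
import Summits.QuantumFields.BalabanUV.T4Continuum.Spine.NE7b.SupPolymerActivityExpansion
import Summits.QuantumFields.BalabanUV.T4Continuum.Spine.NE7b.SupPolymerLocalSmallness

/-!
# THE OUTPUT IN THE SAME FORMAT — THE CLUSTER EXPANSION REGROUPED BY SUPPORT IS AGAIN A SMALL POLYMER-LOCAL FUNCTIONAL: for an activity
# `z` vanishing off the `R`-connected cell sets with `‖z Y‖ ≤ ε^{#Y}` (`R` symmetric, `≤ Δ` neighbours) on a family `L ⊆ 𝒫(C)` of polymers,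
# the Kotecký–Preiss logarithm regroups as
#   `log Ξ(L; z) = Σ_{Y ∈ 𝒫(C)} K⁺(Y)`,   `K⁺(Y) := Σ_{𝒞 ⊆ L, ⋃𝒞 = Y} Φ^T(𝒞)`
# (clusters that are not `GeomInc`-clusters weigh zero, `GeomInc`-clusters of connected sets have CONNECTED unions), with the support terms
#   LOCAL (`K⁺(Y)` sees only `z` on the polymers inside `Y`),  SMALL `‖K⁺(Y)‖ ≤ e^{−τ#Y}·(Δ+1)2e^{1+τ}ε` (`e^{1+τ}ε(Δ+1)² ≤ 1∕2`),
#   of `O(ε)` PINNED WEIGHTED NORM `Σ_{Y∋p}‖K⁺(Y)‖e^{τ#Y} ≤ (Δ+1)2e^{1+τ}ε`,  and GEOMETRICALLY SMALL `‖K⁺(Y)‖ ≤ (Δ+1)2e·(√ε)^{#Y+1}`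
# under `e√ε(Δ+1)² ≤ 1∕2` (`τ = ½log(1∕ε)`): the next potential `W⁺ = −log Z = −Σ_Y K⁺(Y)` IS a polymer-local functional indexed by connected
# cell sets with an exponentially small sup letter — SCOPING-d5 (3) «the closure of the class», abstract half (row NE7b, node U5c; (352) +
# the tree's `truncatedWeight_eq_zero_of_kp` ∕ `sum_fiberwise_eq_sum_filter` + (349)'s connected unions BY NAME; [folklore])

Cell `pub-balaban`, sub-cell `t4`, spine estimate NE7b (`T4WeightBudget.RelWeightBound`; the cell's OWN estimate — NOT PRINTED in
[Bałaban 1983–89], NOT PROVED).  Crux-route work under `Spine/NE7b/` by the row OWNER (`t4-ne7b-p1` gen 134, file (354)) under FREEZE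
(0)'s crux-prover clause, on `g131/records/SCOPING-d5-reentry.md` DECISION (3) and § [NE7bP1-G131-ADDENDUM] NEXT (3)(a)(iii) («(312)'s cluster
sum regrouped by support ⟹ W⁺ = Σ_Y K⁺_Y»); NOTHING of Bałaban's is named as a Lean object, valued or asserted; no `T4Continuum/Support` leaf
typed; no `def`, no notation (`K⁺` is a displayed sum); zero `sorry`.  Imports (BY NAME): the OWNER's (352) `…SupPolymerActivityExpansion`
(`touchSum_decay_le`, `sum_norm_truncatedWeight_large_pinned_le`), (350) `…SupPolymerLocalSmallness` (`card_le_sum_card_of_biUnion_eq`) and through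
it (349) (`isRConnected_biUnion_of_touchConnected`); the tree's `IsPolymerCluster`, `truncatedWeight_eq_zero_of_kp`, `truncatedWeight_empty`,
`truncatedWeight_congr`, `polymerLogZ_eq_sum_truncatedWeight`, `isKPVolume_geomInc`, `KPTouches`, `rconnSubsets`, `mem_rconnSubsets`; Mathlib's
`Finset.sum_fiberwise_eq_sum_filter`, `Finset.sum_filter_of_ne`, `Finset.sdiff_nonempty`, `Real.log_sqrt`, `Real.exp_log`, `Real.exp_nat_mul`.

WHY (located).  SCOPING-d5's gap was «INPUT CLASS ≠ OUTPUT CLASS»: the step's output `−log Z` is not of the one-site form.  (348)–(353) made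
the polymer-local INPUT a convergent gas with activity `z` on connected cell sets; the OUTPUT `log Ξ(L; z) = Σ_𝒞 Φ^T(𝒞)` is a sum over
CLUSTERS.  Regrouping the clusters by their support `Y = ⋃𝒞` turns it into a sum over CONNECTED CELL SETS again, each term local in `Y` and
exponentially small in `#Y` — the same format as the input, so the step can be composed with itself (same sites; blocking ∕ rescaling is
NC-NE7b-α's modelling question, untouched).  This file is the abstract half; the road's letters enter through (353).

WHAT IS PROVED ([folklore]; `hz0`, `hz`, `0 ≤ ε` throughout; `K⁺(Y) = Σ_{𝒞 ∈ L.powerset, ⋃𝒞 = Y}Φ^T(𝒞)` displayed):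
* §1 geometry: **`touchConnected_of_isPolymerCluster`** (a nonempty `GeomInc R`-cluster is touch-connected as a family),
  `isRConnected_biUnion_of_isPolymerCluster`, `biUnion_mem_rconnSubsets_of_isPolymerCluster` (`L ⊆ 𝒫(C)` ⟹ the support of a nonempty cluster
  of `L` lies in `𝒫(C)`), `kpTouches_singleton_of_biUnion_eq` (a cluster with support `Y ∋ p` is pinned at `{p}`), `card_le_clusterSize_of_biUnion_eq`
  (`#Y ≤ ‖𝒞‖`);
* §2 THE REGROUPING (`eε(Δ+1)² ≤ 1∕2`): `truncatedWeight_eq_zero_of_biUnion_not_mem` (clusters whose support is not in `𝒫(C)` weigh zero),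
  THE END **`polymerLogZ_eq_sum_support`** (`log Ξ(L; z) = Σ_{Y∈𝒫(C)}K⁺(Y)`);
* §3 THE LETTERS OF THE OUTPUT: **`supportTerm_congr`** (locality), **`norm_supportTerm_le`** (`‖K⁺(Y)‖ ≤ e^{−τ#Y}(Δ+1)2e^{1+τ}ε`, `Y ≠ ∅`),
  **`sum_norm_supportTerm_weighted_le`** (`Σ_{Y∈T, p∈Y}‖K⁺(Y)‖e^{τ#Y} ≤ (Δ+1)2e^{1+τ}ε` for any index family `T`),
  **`norm_supportTerm_le_sqrt`** (`0 < ε ≤ 1`, `e√ε(Δ+1)² ≤ 1∕2` ⟹ `‖K⁺(Y)‖ ≤ (√ε)^{#Y}·(Δ+1)2e√ε`); §4 toy.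

HONEST (what this is NOT).  Abstract activity level (the road instance — external field, measurability of `K⁺_Y(ψ)` in `ψ`, the one-site part
`K⁺({p})` carrying the old letters — is the successor's); the output letter is a SUP∕norm letter on `K⁺(Y)` as a complex number per support, not a
regulated functional bound; same sites (no blocking ∕ rescaling); scalar skeleton ((A3), NC-NE7b-α UNRULED); nothing of Bałaban's asserted.
BY-NAME EFFECT ON THE WALL: NONE.  NE7b NOT PRINTED ∕ NOT PROVED; spine PROVED 0∕9; rung (B)+1 — the programme's measures remain FINITE-torus
statements; NOT the mass gap, NOT Clay.  HONEST DEPENDENCY: continuum YM on T⁴ ⇐ BetaPertH ∧ nine spine estimates (0∕9 proved); BetaPertH ⇐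
(D1) ∧ (D4) ∧ CAP+tail; G-an2-4 gates asym, D1 and NE2∕3∕4.
-/

set_option autoImplicit false

noncomputable section

namespace Summit.QuantumFields.BalabanUV.T4Continuum.NE7b.SupClusterSupportRegrouping

open Finset Real
open scoped BigOperators
open Literature.Probability.LatticeModels
open SupPolymerLocalResummation (isRConnected_biUnion_of_touchConnected)
open SupPolymerLocalSmallness (card_le_sum_card_of_biUnion_eq)
open SupPolymerActivityExpansion (touchSum_decay_le sum_norm_truncatedWeight_large_pinned_le)

variable {V : Type*} [DecidableEq V] {R : V → V → Prop} [DecidableRel R] {z z' : Finset V → ℂ} {ε τ : ℝ}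
  {nbr : V → Finset V} {Δ : ℕ}

/-! ## §1. Geometry of clusters: connected supports, pinning, size -/

omit [DecidableRel R] in
/-- **A NONEMPTY `GeomInc R`-CLUSTER IS TOUCH-CONNECTED AS A FAMILY**: no cut of the cluster is free of an equal-or-touching pair across it, so
every member is reached from every other by a chain of touching members. [folklore] -/
theorem touchConnected_of_isPolymerCluster {𝒞 : Finset (Finset V)} (h𝒞 : IsPolymerCluster (GeomInc R) 𝒞) (hne : 𝒞.Nonempty) :
    IsRConnected (Touches R) 𝒞 := by
  classical
  refine ⟨hne, fun A hA B hB => ?_⟩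
  set C₁ := 𝒞.filter (fun X => Relation.ReflTransGen (fun x y => Touches R x y ∧ x ∈ 𝒞 ∧ y ∈ 𝒞) A X) with hC₁
  have h1 : C₁ ⊆ 𝒞 := filter_subset _ _
  have hAC₁ : A ∈ C₁ := mem_filter.2 ⟨hA, Relation.ReflTransGen.refl⟩
  have hfull : 𝒞 ⊆ C₁ := by
    by_contra hnot
    obtain ⟨γ₁, hγ₁, γ₂, hγ₂, hinc⟩ := h𝒞 C₁ h1 ⟨A, hAC₁⟩ (sdiff_nonempty.2 hnot)
    obtain ⟨hγ₂𝒞, hγ₂C₁⟩ := mem_sdiff.1 hγ₂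
    obtain ⟨hγ₁𝒞, hr1⟩ := mem_filter.1 hγ₁
    refine hγ₂C₁ (mem_filter.2 ⟨hγ₂𝒞, ?_⟩)
    rcases hinc with heq | ht
    · rw [← heq]; exact hr1
    · exact hr1.tail ⟨ht, hγ₁𝒞, hγ₂𝒞⟩
  exact (mem_filter.1 (hfull hB)).2

omit [DecidableRel R] in
/-- **A nonempty cluster of `R`-connected sets has an `R`-connected support.** [folklore] -/
theorem isRConnected_biUnion_of_isPolymerCluster {𝒞 : Finset (Finset V)} (h𝒞 : IsPolymerCluster (GeomInc R) 𝒞) (hne : 𝒞.Nonempty)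
    (hconn : ∀ Y ∈ 𝒞, IsRConnected R Y) : IsRConnected R (𝒞.biUnion id) :=
  isRConnected_biUnion_of_touchConnected (touchConnected_of_isPolymerCluster h𝒞 hne) hconn

omit [DecidableRel R] in
/-- **The support of a nonempty cluster of polymers of `C` is a polymer of `C`.** [folklore] -/
theorem biUnion_mem_rconnSubsets_of_isPolymerCluster {L : Finset (Finset V)} {C : Finset V} (hL : L ⊆ rconnSubsets R C)
    {𝒞 : Finset (Finset V)} (h𝒞L : 𝒞 ⊆ L) (h𝒞 : IsPolymerCluster (GeomInc R) 𝒞) (hne : 𝒞.Nonempty) :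
    𝒞.biUnion id ∈ rconnSubsets R C := by
  refine mem_rconnSubsets.2 ⟨fun q hq => ?_, isRConnected_biUnion_of_isPolymerCluster h𝒞 hne fun Y hY => (mem_rconnSubsets.1 (hL (h𝒞L hY))).2⟩
  obtain ⟨Y, hY, hqY⟩ := mem_biUnion.1 hq
  exact (mem_rconnSubsets.1 (hL (h𝒞L hY))).1 hqY

omit [DecidableRel R] in
/-- **A family with support `Y ∋ p` is pinned at `{p}`.** [folklore] -/
theorem kpTouches_singleton_of_biUnion_eq {𝒞 : Finset (Finset V)} {Y : Finset V} (hU : 𝒞.biUnion id = Y) {p : V} (hp : p ∈ Y) :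
    KPTouches (GeomInc R) 𝒞 {p} := by
  rw [← hU] at hp
  obtain ⟨Y', hY', hpY'⟩ := mem_biUnion.1 hp
  exact ⟨Y', hY', Or.inr ⟨p, hpY', p, mem_singleton_self p, Or.inl rfl⟩⟩

/-- **`#Y ≤ ‖𝒞‖`** for a family with support `Y`. [folklore] -/
theorem card_le_clusterSize_of_biUnion_eq {𝒞 : Finset (Finset V)} {Y : Finset V} (hU : 𝒞.biUnion id = Y) :
    (Y.card : ℝ) ≤ ∑ Y' ∈ 𝒞, (Y'.card : ℝ) := by
  exact_mod_cast card_le_sum_card_of_biUnion_eq hU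

/-! ## §2. The regrouping by support -/

/-- **Clusters whose support is not a polymer of `C` weigh zero** (`L ⊆ 𝒫(C)`, `eε(Δ+1)² ≤ 1∕2`): the empty family (`Φ^T(∅) = 0`), and the
non-clusters (the tree's `truncatedWeight_eq_zero_of_kp` in the KP volume `L`); a nonempty cluster HAS its support in `𝒫(C)`. [folklore] -/
theorem truncatedWeight_eq_zero_of_biUnion_not_mem (hR : ∀ x y, R x y → R y x) (hΔ : ∀ x, (nbr x).card ≤ Δ)
    (hnbr : ∀ x y, R x y → y ∈ nbr x) (hz0 : ∀ Y, ¬ IsRConnected R Y → z Y = 0) (hz : ∀ Y, ‖z Y‖ ≤ ε ^ Y.card) (hε : 0 ≤ ε)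
    (hsmall : Real.exp 1 * ε * ((Δ : ℝ) + 1) ^ 2 ≤ 1 / 2) {L : Finset (Finset V)} {C : Finset V} (hL : L ⊆ rconnSubsets R C)
    {𝒞 : Finset (Finset V)} (h𝒞L : 𝒞 ∈ L.powerset) (hY : 𝒞.biUnion id ∉ rconnSubsets R C) :
    truncatedWeight (GeomInc R) z 𝒞 = 0 := by
  haveI : Std.Symm R := ⟨hR⟩
  by_cases hne : 𝒞.Nonempty
  · by_cases hcl : IsPolymerCluster (GeomInc R) 𝒞
    · exact absurd (biUnion_mem_rconnSubsets_of_isPolymerCluster hL (mem_powerset.1 h𝒞L) hcl hne) hY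
    · exact truncatedWeight_eq_zero_of_kp (isKPVolume_geomInc hR hΔ hnbr hε hsmall z hz0 hz L) (mem_powerset.1 h𝒞L) hcl
  · rw [not_nonempty_iff_eq_empty.1 hne, truncatedWeight_empty]

/-- **THE END — THE CLUSTER EXPANSION REGROUPED BY SUPPORT.**  `R` symmetric with `≤ Δ` neighbours, `z` vanishing off `R`-connected sets with
`‖z Y‖ ≤ ε^{#Y}`, `0 ≤ ε`, `eε(Δ+1)² ≤ 1∕2`, `L ⊆ 𝒫(C)` ⟹
`log Ξ(L; z) = Σ_{Y ∈ 𝒫(C)} K⁺(Y)`, `K⁺(Y) = Σ_{𝒞 ⊆ L, ⋃𝒞 = Y}Φ^T(𝒞)` — a sum over CONNECTED CELL SETS of support terms. [folklore] -/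
theorem polymerLogZ_eq_sum_support (hR : ∀ x y, R x y → R y x) (hΔ : ∀ x, (nbr x).card ≤ Δ) (hnbr : ∀ x y, R x y → y ∈ nbr x)
    (hz0 : ∀ Y, ¬ IsRConnected R Y → z Y = 0) (hz : ∀ Y, ‖z Y‖ ≤ ε ^ Y.card) (hε : 0 ≤ ε)
    (hsmall : Real.exp 1 * ε * ((Δ : ℝ) + 1) ^ 2 ≤ 1 / 2) {L : Finset (Finset V)} {C : Finset V} (hL : L ⊆ rconnSubsets R C) :
    polymerLogZ (GeomInc R) z L =
      ∑ Y ∈ rconnSubsets R C, ∑ 𝒞 ∈ L.powerset with 𝒞.biUnion id = Y, truncatedWeight (GeomInc R) z 𝒞 := by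
  rw [polymerLogZ_eq_sum_truncatedWeight, sum_fiberwise_eq_sum_filter]
  exact (sum_filter_of_ne fun 𝒞 h𝒞 hne => by
    by_contra hY
    exact hne (truncatedWeight_eq_zero_of_biUnion_not_mem hR hΔ hnbr hz0 hz hε hsmall hL h𝒞 hY)).symm

/-! ## §3. The letters of the output: locality, exponential smallness, pinned weighted norm -/

omit [DecidableRel R] in
/-- **LOCALITY OF THE SUPPORT TERMS**: `K⁺(Y)` depends only on the activities of the polymers of `L` INSIDE `Y`. [folklore] -/
theorem supportTerm_congr [DecidableRel R] (L : Finset (Finset V)) (Y : Finset V) (hagree : ∀ Y' ∈ L, Y' ⊆ Y → z Y' = z' Y') :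
    ∑ 𝒞 ∈ L.powerset with 𝒞.biUnion id = Y, truncatedWeight (GeomInc R) z 𝒞 =
      ∑ 𝒞 ∈ L.powerset with 𝒞.biUnion id = Y, truncatedWeight (GeomInc R) z' 𝒞 := by
  refine sum_congr rfl fun 𝒞 h𝒞 => truncatedWeight_congr fun Y' hY' => ?_
  obtain ⟨h𝒞L, hU⟩ := mem_filter.1 h𝒞
  exact hagree Y' (mem_powerset.1 h𝒞L hY') (hU ▸ subset_biUnion_of_mem id hY')

/-- **THE SUPPORT TERMS ARE EXPONENTIALLY SMALL IN THE SUPPORT**: `0 ≤ τ`, `e^{1+τ}ε(Δ+1)² ≤ 1∕2`, `Y` nonempty ⟹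
`‖K⁺(Y)‖ ≤ e^{−τ#Y}·(Δ+1)·2e^{1+τ}ε` on ANY family `L` (every family with support `Y ∋ p` is pinned at `{p}` and has `‖𝒞‖ ≥ #Y`). [folklore] -/
theorem norm_supportTerm_le (hR : ∀ x y, R x y → R y x) (hΔ : ∀ x, (nbr x).card ≤ Δ) (hnbr : ∀ x y, R x y → y ∈ nbr x)
    (hz0 : ∀ Y, ¬ IsRConnected R Y → z Y = 0) (hz : ∀ Y, ‖z Y‖ ≤ ε ^ Y.card) (hε : 0 ≤ ε) (hτ : 0 ≤ τ)
    (hsmall : Real.exp (1 + τ) * ε * ((Δ : ℝ) + 1) ^ 2 ≤ 1 / 2) (L : Finset (Finset V)) {Y : Finset V} (hY : Y.Nonempty) :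
    ‖∑ 𝒞 ∈ L.powerset with 𝒞.biUnion id = Y, truncatedWeight (GeomInc R) z 𝒞‖ ≤
      Real.exp (-(τ * Y.card)) * (((Δ : ℝ) + 1) * (2 * (Real.exp (1 + τ) * ε))) := by
  obtain ⟨p, hp⟩ := hY
  have h := sum_norm_truncatedWeight_large_pinned_le hR hΔ hnbr hz0 hz hε hτ hsmall L {p} (Y.card : ℝ)
  simp only [card_singleton, Nat.cast_one, one_mul] at h
  refine (norm_sum_le _ _).trans (le_trans (sum_le_sum_of_subset_of_nonneg (fun 𝒞 h𝒞 => ?_) fun _ _ _ => norm_nonneg _) h)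
  obtain ⟨h𝒞L, hU⟩ := mem_filter.1 h𝒞
  exact mem_filter.2 ⟨h𝒞L, kpTouches_singleton_of_biUnion_eq hU hp, card_le_clusterSize_of_biUnion_eq hU⟩

/-- **THE PINNED WEIGHTED NORM OF THE OUTPUT IS `O(ε)`**: `0 ≤ τ`, `e^{1+τ}ε(Δ+1)² ≤ 1∕2` ⟹ for every cell `p` and every index family `T` of
supports, `Σ_{Y ∈ T, p ∈ Y}‖K⁺(Y)‖·e^{τ#Y} ≤ (Δ+1)·2e^{1+τ}ε` — the Kotecký–Preiss-type norm in which the output is an input again. [folklore] -/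
theorem sum_norm_supportTerm_weighted_le (hR : ∀ x y, R x y → R y x) (hΔ : ∀ x, (nbr x).card ≤ Δ) (hnbr : ∀ x y, R x y → y ∈ nbr x)
    (hz0 : ∀ Y, ¬ IsRConnected R Y → z Y = 0) (hz : ∀ Y, ‖z Y‖ ≤ ε ^ Y.card) (hε : 0 ≤ ε) (hτ : 0 ≤ τ)
    (hsmall : Real.exp (1 + τ) * ε * ((Δ : ℝ) + 1) ^ 2 ≤ 1 / 2) (L T : Finset (Finset V)) (p : V) :
    ∑ Y ∈ T with p ∈ Y, ‖∑ 𝒞 ∈ L.powerset with 𝒞.biUnion id = Y, truncatedWeight (GeomInc R) z 𝒞‖ * Real.exp (τ * Y.card) ≤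
      ((Δ : ℝ) + 1) * (2 * (Real.exp (1 + τ) * ε)) := by
  set Φ : Finset (Finset V) → ℂ := truncatedWeight (GeomInc R) z with hΦ
  have h := touchSum_decay_le hR hΔ hnbr hz0 hz hε hτ hsmall L {p}
  simp only [card_singleton, Nat.cast_one, one_mul] at h
  refine le_trans ?_ h
  calc ∑ Y ∈ T with p ∈ Y, ‖∑ 𝒞 ∈ L.powerset with 𝒞.biUnion id = Y, Φ 𝒞‖ * Real.exp (τ * Y.card)
      ≤ ∑ Y ∈ T with p ∈ Y, ∑ 𝒞 ∈ L.powerset with 𝒞.biUnion id = Y, ‖Φ 𝒞‖ * Real.exp (∑ Y' ∈ 𝒞, τ * (Y'.card : ℝ)) := by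
        refine sum_le_sum fun Y _ => ?_
        calc ‖∑ 𝒞 ∈ L.powerset with 𝒞.biUnion id = Y, Φ 𝒞‖ * Real.exp (τ * Y.card)
            ≤ (∑ 𝒞 ∈ L.powerset with 𝒞.biUnion id = Y, ‖Φ 𝒞‖) * Real.exp (τ * Y.card) :=
              mul_le_mul_of_nonneg_right (norm_sum_le _ _) (exp_pos _).le
          _ = ∑ 𝒞 ∈ L.powerset with 𝒞.biUnion id = Y, ‖Φ 𝒞‖ * Real.exp (τ * Y.card) := sum_mul _ _ _
          _ ≤ _ := sum_le_sum fun 𝒞 h𝒞 => mul_le_mul_of_nonneg_left (exp_le_exp.2 (by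
              rw [← mul_sum]
              exact mul_le_mul_of_nonneg_left (card_le_clusterSize_of_biUnion_eq (mem_filter.1 h𝒞).2) hτ)) (norm_nonneg _)
    _ = ∑ 𝒞 ∈ L.powerset with 𝒞.biUnion id ∈ T.filter (fun Y => p ∈ Y), ‖Φ 𝒞‖ * Real.exp (∑ Y' ∈ 𝒞, τ * (Y'.card : ℝ)) :=
        sum_fiberwise_eq_sum_filter _ _ _ _
    _ ≤ ∑ 𝒞 ∈ L.powerset with KPTouches (GeomInc R) 𝒞 {p}, ‖Φ 𝒞‖ * Real.exp (∑ Y' ∈ 𝒞, τ * (Y'.card : ℝ)) := by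
        refine sum_le_sum_of_subset_of_nonneg (fun 𝒞 h𝒞 => ?_) fun _ _ _ => by positivity
        obtain ⟨h𝒞L, hT⟩ := mem_filter.1 h𝒞
        exact mem_filter.2 ⟨h𝒞L, kpTouches_singleton_of_biUnion_eq rfl (mem_filter.1 hT).2⟩

/-- **THE OUTPUT IS GEOMETRICALLY SMALL IN THE SUPPORT**: `0 < ε ≤ 1`, `e·√ε·(Δ+1)² ≤ 1∕2`, `Y` nonempty ⟹
`‖K⁺(Y)‖ ≤ (√ε)^{#Y}·(Δ+1)·2e√ε` (the choice `τ = ½log(1∕ε)`: `e^{1+τ}ε = e√ε`, `e^{−τ#Y} = (√ε)^{#Y}`) — a sup letter `≲ (√ε)^{#Y+1}` of the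
same shape as the input letter `ε^{#X}`. [folklore] -/
theorem norm_supportTerm_le_sqrt (hR : ∀ x y, R x y → R y x) (hΔ : ∀ x, (nbr x).card ≤ Δ) (hnbr : ∀ x y, R x y → y ∈ nbr x)
    (hz0 : ∀ Y, ¬ IsRConnected R Y → z Y = 0) (hz : ∀ Y, ‖z Y‖ ≤ ε ^ Y.card) (hε : 0 < ε) (hε1 : ε ≤ 1)
    (hsmall : Real.exp 1 * Real.sqrt ε * ((Δ : ℝ) + 1) ^ 2 ≤ 1 / 2) (L : Finset (Finset V)) {Y : Finset V} (hY : Y.Nonempty) :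
    ‖∑ 𝒞 ∈ L.powerset with 𝒞.biUnion id = Y, truncatedWeight (GeomInc R) z 𝒞‖ ≤
      Real.sqrt ε ^ Y.card * (((Δ : ℝ) + 1) * (2 * (Real.exp 1 * Real.sqrt ε))) := by
  set τ : ℝ := -Real.log (Real.sqrt ε) with hτdef
  have hs0 : 0 < Real.sqrt ε := Real.sqrt_pos.2 hε
  have hs1 : Real.sqrt ε ≤ 1 := Real.sqrt_le_one.2 hε1
  have hτ : 0 ≤ τ := by rw [hτdef]; linarith [Real.log_nonpos hs0.le hs1]
  have hexpτ : Real.exp τ * Real.sqrt ε = 1 := by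
    rw [hτdef, Real.exp_neg, Real.exp_log hs0, inv_mul_cancel₀ hs0.ne']
  have hexpnegτ : Real.exp (-τ) = Real.sqrt ε := by rw [hτdef, neg_neg, Real.exp_log hs0]
  -- `e^{1+τ}·ε = e·√ε`
  have hkey : Real.exp (1 + τ) * ε = Real.exp 1 * Real.sqrt ε := by
    rw [Real.exp_add]
    conv_lhs => rw [← Real.mul_self_sqrt hε.le]
    calc Real.exp 1 * Real.exp τ * (Real.sqrt ε * Real.sqrt ε) = Real.exp 1 * (Real.exp τ * Real.sqrt ε) * Real.sqrt ε := by ring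
      _ = Real.exp 1 * Real.sqrt ε := by rw [hexpτ, mul_one]
  have hsmallτ : Real.exp (1 + τ) * ε * ((Δ : ℝ) + 1) ^ 2 ≤ 1 / 2 := by rw [hkey]; exact hsmall
  have h := norm_supportTerm_le hR hΔ hnbr hz0 hz hε.le hτ hsmallτ L hY
  have hpow : Real.exp (-(τ * Y.card)) = Real.sqrt ε ^ Y.card := by
    rw [show -(τ * (Y.card : ℝ)) = (Y.card : ℝ) * (-τ) by ring, Real.exp_nat_mul, hexpnegτ]
  rw [hpow, hkey] at h
  exact h

/-! ## §4. Toy -/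

omit [DecidableRel R] in
/-- Toy (§1): the one-member family `{{a}}` has support `{a} ∋ a`, so it is pinned at `{a}`. -/
example (a : V) : KPTouches (GeomInc R) ({{a}} : Finset (Finset V)) {a} :=
  kpTouches_singleton_of_biUnion_eq (Y := {a}) (by simp) (mem_singleton_self a)

end Summit.QuantumFields.BalabanUV.T4Continuum.NE7b.SupClusterSupportRegrouping
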